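import Summits.CriticalPhenomena.Ising3DConformalLimit.Theses.MonotoneBlocking
import Summits.CriticalPhenomena.Ising3DConformalLimit.Theses.MirrorHoelderCompactness
import Summits.CriticalPhenomena.Ising3DConformalLimit.Theorems.HyperoctahedralRPExistsScaleCovariantLimitNonSeparableModulusOfUniformRegularity
import Summits.CriticalPhenomena.Ising3DConformalLimit.Theorems.HyperoctahedralRPExistsScaleCovariantLimitCompactnessItemMapsDoubling
import Summits.CriticalPhenomena.Ising3DConformalLimit.Theorems.MonotoneBlockingNonSeparableModulusAxialPincer
import HarnessLib

/-!
# Crux `NonSeparableModulus` (stmt-CriticalPhenomena-6152) — line `AxialPincer`, lead skeleton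

Routes `MonotoneBlocking` / `MirrorHoelderCompactness` (the two route decls are the same proposition),
sub-problem `CriticalPhenomena/Ising3DConformalLimit`. Lead `prover-line-stmt-CriticalPhenomena-6152-0`;
re-registered unchanged by continuation leads c1 (`…-6152-c1-0`) and c2 (`…-6152-c2-0`, 2026-08-17T13:35Z).

THE LINE. `NonSeparableModulus ⟺ TwoPointDoubling` (item stmt-CriticalPhenomena-6150):
* `⟸` is landed glue: `TwoHierarchies.ItemMaps.uniformRegularity_of_doubling` (6150 ⟹ 4658) and
  `TwoHierarchies.stub_nonSeparableModulus_of_uniformRegularity` (4658 ⟹ 6152) — this is `NonSeparableModulus_of`;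
* `⟹` (the axial pincer, evidence `AxialPincer.lean` of crux-ideate k2) is LANDED by the lead:
  `Theorems/MonotoneBlockingNonSeparableModulusAxialPincerCore.lean` (p159016) and
  `Theorems/MonotoneBlockingNonSeparableModulusAxialPincer.lean` (p159449: `twoPointDoubling_of_nonSeparableModulus`,
  `nonSeparableModulus_iff_twoPointDoubling`, `mirror_nonSeparableModulus_iff_twoPointDoubling`), `--supports 6152` —
  recorded below as `stub_of_NonSeparableModulus` (the stub is NECESSARY, not only sufficient).
Hence the line has exactly ONE stub, and that stub is the signature of item 6150 VERBATIM: no reshaping of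
the crux can produce a stub set avoiding it (any proof of the crux is a proof of 6150, kernel-checked).
The stub is not delegable to a worker (it is a registered ITEM with its own crux chain,
`Cruxes/TwoPointDoubling`, best landed result √n-doubling p146786, barrier
`Literature.Barriers.CriticalPhenomena.AxisProfileAxiomaticsNoDoubling`); when `TwoPointDoubling` lands,
`NonSeparableModulus_of` closes this crux in one line.

Disproof.lean for this crux (cdisprove cycle-1 close-out @ 9b30f68467b7, read by c2): §5 "no attackable stub" —
`stub_twoPointDoubling` is false iff NS is false iff the conjunct `Ising3DConformalLimit` is false
(`Negative/NecessaryForSummit.lean` p160017, `Negative/Equivalences.lean` p160302); the load-bearing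
hypotheses (`NonCoincident`, `IsCompact`) and the refuted `∃δ₀ ∀K` strengthening concern the crux statement,
not this line.
-/

noncomputable section

namespace Summit.CriticalPhenomena.Ising3DConformalLimit.Cruxes.NonSeparableModulus.AxialPincerLine

open Literature.Probability.LatticeModels
open Summit.CriticalPhenomena.Ising3DConformalLimit.Theses
open Summit.CriticalPhenomena.Ising3DConformalLimit.Cruxes.ExistsScaleCovariantLimit

/-- **Stub (the line's only one) = item stmt-CriticalPhenomena-6150 `TwoPointDoubling`, verbatim**:
all-scale doubling `κ·g(n) ≤ g(2n)` of the axial critical two-point function `g(n) = ⟨σ₀σ_{n e₀}⟩_{β_c(3)}`.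
Open problem (Aizenman–Duminil-Copin 2021, Remark 5.10). -/
theorem stub_twoPointDoubling :
    ∃ κ : ℝ, 0 < κ ∧ ∀ n : ℕ, 1 ≤ n →
      κ * criticalTwoPoint 3 (Pi.single 0 (n : ℤ)) ≤ criticalTwoPoint 3 (Pi.single 0 (2 * (n : ℤ))) := by
  sorry

/-- **The stub is necessary**: the crux implies it (landed `twoPointDoubling_of_nonSeparableModulus`, p159449), so no
reshaping of this skeleton can avoid item 6150. -/
theorem stub_of_NonSeparableModulus (h : MonotoneBlocking.NonSeparableModulus) :
    ∃ κ : ℝ, 0 < κ ∧ ∀ n : ℕ, 1 ≤ n →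
      κ * criticalTwoPoint 3 (Pi.single 0 (n : ℤ)) ≤ criticalTwoPoint 3 (Pi.single 0 (2 * (n : ℤ))) :=
  MonotoneBlockingNonSeparableModulusAxialPincer.twoPointDoubling_of_nonSeparableModulus h

/-- **Glue**: the stub (= `TwoPointDoubling`) gives the crux, by the landed item maps
6150 ⟹ 4658 (`ItemMaps.uniformRegularity_of_doubling`) ⟹ 6152 (`stub_nonSeparableModulus_of_uniformRegularity`). -/
theorem NonSeparableModulus_of
    (hD : ∃ κ : ℝ, 0 < κ ∧ ∀ n : ℕ, 1 ≤ n →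
      κ * criticalTwoPoint 3 (Pi.single 0 (n : ℤ)) ≤ criticalTwoPoint 3 (Pi.single 0 (2 * (n : ℤ)))) :
    MonotoneBlocking.NonSeparableModulus :=
  TwoHierarchies.stub_nonSeparableModulus_of_uniformRegularity
    (TwoHierarchies.ItemMaps.uniformRegularity_of_doubling hD)

/-- The `MirrorHoelderCompactness` copy of the glue (same proposition). -/
theorem NonSeparableModulus_of'
    (hD : ∃ κ : ℝ, 0 < κ ∧ ∀ n : ℕ, 1 ≤ n →
      κ * criticalTwoPoint 3 (Pi.single 0 (n : ℤ)) ≤ criticalTwoPoint 3 (Pi.single 0 (2 * (n : ℤ)))) :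
    MirrorHoelderCompactness.NonSeparableModulus :=
  NonSeparableModulus_of hD

/-- The crux from the registered stub plugged in (closed modulo exactly `stub_twoPointDoubling`). -/
theorem NonSeparableModulus_proof : MonotoneBlocking.NonSeparableModulus :=
  NonSeparableModulus_of stub_twoPointDoubling

/-- The `MirrorHoelderCompactness` copy of the crux from the registered stub. -/
theorem NonSeparableModulus_proof' : MirrorHoelderCompactness.NonSeparableModulus :=
  NonSeparableModulus_of' stub_twoPointDoubling

end Summit.CriticalPhenomena.Ising3DConformalLimit.Cruxes.NonSeparableModulus.AxialPincerLine

end
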